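import Mathlib
import Summits.NavierStokesRegularity.NavierStokesRegularity.Theorems.ThreadingFluxAzimuthalCartanConicalWitnessCone
import HarnessLib

/-!
# Crux `PoloidalLiouville` (stmt-NavierStokesRegularity-1222, wall W1), crux idea «azimuthal-cartan-test» (ns-idea-15 g10):
# K♯ ON EVERY BALL OF THE CONE — the rational conical flow has `curl ≢ 0` and NO symmetry axis on every ball of its cone of smoothness

Support file (`--supports stmt-NavierStokesRegularity-1222`, helper; cell `ns-wall-extremal`, width hand ns-wall-eng-6 g5, 0 kit).
K♯ `PoloidalConicalFlows` (BY NAME: `AzimuthalCartan.poloidalConicalFlows`, `…ConicalWitnessNoAxis`) exhibits ONE ball.  Here the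
register sentence «ball-local `(−1)`-homogeneous unthreaded steady rigidity is FALSE on EVERY ball of the cone of smoothness» becomes a
kernel fact for the explicit flow `u = conicalField Φ`, `e^{Φ} = N/D²`, on `coneSet = {N > 0} = ℝ³ ∖ (vertex ∪ four rays)`:

* PARITY: `N`, `D`, `Φ`, `h` are even and `∇Φ` odd under `x ↦ −x`, hence `u(−x) = −u(x)` and `Du(−x) = Du(x)` on the cone
  (`conicalField_neg`, `fderiv_conicalField_neg`); so an equivariance identity / a vanishing curl on a ball `B` also holds on `−B`;
* ANALYTIC CONTINUATION in the CONVEX half-space `U⁺ = {x₂ > 0} ⊆ coneSet` (`eqOn_zero_upperHalf_of_ball`): a real-analytic map on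
  the cone vanishing on a ball `B ⊆ coneSet` vanishes on `U⁺`, because `B ∪ (−B)` always meets `U⁺` in a non-empty open set
  (Mathlib `AnalyticOnNhd.eqOn_zero_of_preconnected_of_eventuallyEq_zero`);
* `not_isEquivariantOn_coneBall` — the swirl-free form of `…NoAxis.noAxis` at the reference ball `B((1,1,1), ½) ⊆ U⁺`;
* ★ `noAxis_ball`, ★ `exists_curl_ne_zero_ball` — on EVERY ball `B ⊆ coneSet`: no skew `A ≠ 0` with `Du[Ax] = Au` on `B`, and `curl u ≢ 0`
  on `B` (the defect `y ↦ Du(y)[Ay] − Au(y)` and `curl u` are real-analytic on the cone: `ContDiffAt.fderiv_right` + `clm_apply`);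
* ★★ `poloidalConicalFlows_everyBall` — all seven clauses of K♯ on every ball `B ⊆ coneSet` with centre of homogeneity the vertex `0`.

HONEST FRAME: information on one idea card's LOCAL statement, strictly below W1; with eng-7's C♭-FALSE-on-every-ball (p717710/p717920,
inhomogeneous witnesses) the surviving rigid local shapes for the W1 Cartan line remain: balls containing the centre, full shells about
the centre (C♯; homogeneous stratum TRUE, p711757), global.  `PoloidalLiouville` (1222) and NS regularity OPEN / NOT proved.
-/

-- the summit and its single sub-problem share the name (CONVENTIONS §1)
set_option linter.dupNamespace false

noncomputable section

namespace Summit.NavierStokesRegularity.NavierStokesRegularity.Theorems.PoloidalLiouville.AzimuthalCartan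

open Set Function Filter Topology Metric
open scoped ContDiff RealInnerProductSpace
open Literature.Analysis.FluidPDE
open Summit.NavierStokesRegularity.NavierStokesRegularity.Theorems.PoloidalLiouville.CentreJet (E3 IsSteadyNSOn)
open Summit.NavierStokesRegularity.NavierStokesRegularity.Theorems.RotatingEulerWindowProfileLinearRung
  (cross_apply_zero cross_apply_one cross_apply_two)
open Jordan (dx e dx_apply)

namespace ConicalWitness

/-! ### Parity under `x ↦ −x` -/

variable (x : E3)

/-- `N` is even. -/
theorem quartN_neg : quartN (-x) = quartN x := by
  simp only [quartN, PiLp.neg_apply]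
  ring

/-- `D` is even. -/
theorem quadD_neg : quadD (-x) = quadD x := by
  simp only [quadD, PiLp.neg_apply]
  ring

/-- `∇N` is odd. -/
theorem gradN_neg : gradN (-x) = -gradN x := by
  ext i
  fin_cases i <;> simp [gradN] <;> ring

/-- `∇D` is odd. -/
theorem gradD_neg : gradD (-x) = -gradD x := by
  ext i
  fin_cases i <;> simp [gradD]

/-- `∇²N` is even. -/
theorem hessN_neg : hessN (-x) = hessN x := by
  ext v i
  simp only [hessN_apply, PiLp.neg_apply, mul_neg, neg_mul, neg_neg, even_two, Even.neg_pow]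

/-- `g = ∇Φ` is odd. -/
theorem grad_neg : grad (-x) = -grad x := by
  rw [grad, grad, quartN_neg, quadD_neg, gradN_neg, gradD_neg, smul_neg, smul_neg, neg_sub_neg, neg_sub']
  abel

/-- `H = ∇²Φ` is even. -/
theorem hess_neg : hess (-x) = hess x := by
  rw [hess, hess, quartN_neg, quadD_neg, hessN_neg, gradN_neg, gradD_neg]
  ext v i
  simp only [add_apply, sub_apply, smul_apply, ContinuousLinearMap.smulRight_apply, innerSL_apply_apply, inner_neg_left, smul_neg,
    neg_smul, neg_neg]

/-- `Φ` is even. -/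
theorem potential_neg : potential (-x) = potential x := by rw [potential, potential, quartN_neg, quadD_neg]

/-- `h` is even. -/
theorem radialCoeff_neg : radialCoeff potential (-x) = radialCoeff potential x := by
  rw [radialCoeff, radialCoeff, potential_neg, norm_neg]

/-- `Dh` is odd. -/
theorem dRadial_neg : dRadial potential grad (-x) = -dRadial potential grad x := by
  rw [dRadial_eq_innerSL, dRadial_eq_innerSL, potential_neg, norm_neg, radialCoeff_neg, grad_neg, smul_neg, smul_neg, neg_sub_neg,
    ← map_neg, neg_sub]

/-- The Jacobian formula is even: `dField(−x) = dField(x)`. -/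
theorem dField_neg : dField potential grad hess (-x) = dField potential grad hess x := by
  rw [dField, dField, hess_neg, radialCoeff_neg, dRadial_neg]
  ext v i
  simp only [add_apply, smul_apply, ContinuousLinearMap.smulRight_apply, neg_apply, PiLp.add_apply, PiLp.smul_apply, PiLp.neg_apply,
    smul_eq_mul, neg_mul_neg, ContinuousLinearMap.id_apply]

variable {x}

/-- The cone is symmetric under `x ↦ −x`. -/
theorem neg_mem_coneSet (hx : x ∈ coneSet) : -x ∈ coneSet := by
  show 0 < quartN (-x)
  rw [quartN_neg]
  exact hx

/-- **The flow is odd**: `u(−x) = −u(x)` on the cone. -/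
theorem conicalField_neg (hx : x ∈ coneSet) : conicalField potential (-x) = -conicalField potential x := by
  rw [liouvilleCone_coneSet.conicalField_eq (neg_mem_coneSet hx), liouvilleCone_coneSet.conicalField_eq hx, grad_neg, radialCoeff_neg,
    smul_neg, neg_add]

/-- **Its Jacobian is even**: `Du(−x) = Du(x)` on the cone. -/
theorem fderiv_conicalField_neg (hx : x ∈ coneSet) :
    fderiv ℝ (conicalField potential) (-x) = fderiv ℝ (conicalField potential) x := by
  rw [liouvilleCone_coneSet.fderiv_conicalField (neg_mem_coneSet hx), liouvilleCone_coneSet.fderiv_conicalField hx, dField_neg]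

/-! ### Analyticity of the defect maps on the cone -/

/-- `u` is `C^ω` at every point of the cone. -/
theorem contDiffAt_conicalField (hx : x ∈ coneSet) : ContDiffAt ℝ (⊤ : WithTop ℕ∞) (conicalField potential) x :=
  (steadyNS_on_coneSet.1 x hx).contDiffAt

/-- The equivariance defect `y ↦ Du(y)[A y] − A u(y)` is real-analytic on the cone. -/
theorem analyticAt_defect (A : E3 →L[ℝ] E3) (hx : x ∈ coneSet) :
    AnalyticAt ℝ (fun y => fderiv ℝ (conicalField potential) y (A y) - A (conicalField potential y)) x := by
  have hV := contDiffAt_conicalField hx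
  have hD : ContDiffAt ℝ (⊤ : WithTop ℕ∞) (fderiv ℝ (conicalField potential)) x := hV.fderiv_right le_rfl
  exact ((hD.clm_apply A.contDiff.contDiffAt).sub (A.contDiff.contDiffAt.comp x hV)).analyticAt

/-- The vorticity is real-analytic on the cone. -/
theorem analyticAt_curl (hx : x ∈ coneSet) : AnalyticAt ℝ (curl (conicalField potential)) x := by
  rw [curl_eq_curlCLM_comp]
  exact (curlCLM.contDiff.contDiffAt.comp x ((contDiffAt_conicalField hx).fderiv_right le_rfl)).analyticAt

/-! ### The upper half-space `U⁺ = {x₂ > 0}` and analytic continuation -/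

/-- `U⁺ ⊆ coneSet` (`N ≥ 64x₂⁴ > 0`). -/
theorem upperHalf_subset_coneSet : {y : E3 | 0 < y 2} ⊆ coneSet := fun y hy => by
  have hy2 : 0 < y 2 := hy
  show 0 < quartN y
  rw [quartN_eq_sq_add]
  have : 0 < 16 * y 2 ^ 2 * (3 * y 0 ^ 2 + 5 * y 1 ^ 2 + 4 * y 2 ^ 2) := by positivity
  nlinarith [sq_nonneg (3 * y 0 ^ 2 - 5 * y 1 ^ 2)]

/-- `U⁺` is open. -/
theorem isOpen_upperHalf : IsOpen {y : E3 | 0 < y 2} :=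
  isOpen_lt continuous_const (EuclideanSpace.proj (2 : Fin 3)).continuous

/-- `U⁺` is preconnected (convex). -/
theorem isPreconnected_upperHalf : IsPreconnected {y : E3 | 0 < y 2} :=
  (convex_halfSpace_gt ((EuclideanSpace.proj (2 : Fin 3) : E3 →L[ℝ] ℝ) : E3 →ₗ[ℝ] ℝ).isLinear 0).isPreconnected

/-- The reference ball lies in `U⁺`. -/
theorem coneBall_subset_upperHalf : coneBall ⊆ {y : E3 | 0 < y 2} := fun y hy => by
  have := half_lt_apply hy 2
  show 0 < y 2
  linarith

/-- **Analytic continuation from any ball of the cone to `U⁺`.**  A map, real-analytic on `U⁺`, that vanishes on a ball `B` and at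
every `y` with `−y ∈ B`, vanishes on `U⁺` — for `B ∪ (−B)` meets `U⁺` in a non-empty open set. -/
theorem eqOn_zero_upperHalf_of_ball {F : Type*} [NormedAddCommGroup F] [NormedSpace ℝ F] {f : E3 → F}
    (hf : AnalyticOnNhd ℝ f {y : E3 | 0 < y 2}) {c : E3} {r : ℝ} (hr : 0 < r) (h₁ : ∀ y ∈ ball c r, f y = 0)
    (h₂ : ∀ y : E3, -y ∈ ball c r → f y = 0) : EqOn f 0 {y : E3 | 0 < y 2} := by
  -- a point of `U⁺` near which `f` vanishes
  obtain ⟨z₀, hz₀, hfz₀⟩ : ∃ z₀ ∈ {y : E3 | 0 < y 2}, f =ᶠ[𝓝 z₀] 0 := by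
    rcases lt_trichotomy (c 2) 0 with hc | hc | hc
    · refine ⟨-c, by simpa using hc, ?_⟩
      have hmem : -c ∈ (fun y : E3 => -y) ⁻¹' ball c r := by simp [hr]
      filter_upwards [(isOpen_ball.preimage continuous_neg).mem_nhds hmem] with y hy using h₂ y hy
    · have hmem : c + (r / 2) • e 2 ∈ ball c r := by
        rw [mem_ball, dist_eq_norm, add_sub_cancel_left, norm_smul, Real.norm_eq_abs, abs_of_pos (by positivity)]
        simp [e]
        linarith
      refine ⟨c + (r / 2) • e 2, ?_, ?_⟩
      · have h2 : (c + (r / 2) • e 2) 2 = c 2 + r / 2 := by simp [e]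
        show 0 < (c + (r / 2) • e 2) 2
        rw [h2, hc]
        linarith
      · filter_upwards [isOpen_ball.mem_nhds hmem] with y hy using h₁ y hy
    · exact ⟨c, hc, by filter_upwards [isOpen_ball.mem_nhds (mem_ball_self hr)] with y hy using h₁ y hy⟩
  exact hf.eqOn_zero_of_preconnected_of_eventuallyEq_zero isPreconnected_upperHalf hz₀ hfz₀

/-! ### No axis at the reference ball, swirl-free form -/

/-- The swirl-free form of `noAxis`: no non-zero skew `A` makes `u` infinitesimally `A`-equivariant about `0` on `B((1,1,1), ½)`. -/
theorem not_isEquivariantOn_coneBall {A : E3 →L[ℝ] E3} (hA : IsSkewAxis A) : ¬ IsEquivariantOn coneBall 0 A (conicalField potential) := by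
  obtain ⟨hskew, hA0⟩ := hA
  intro hE
  obtain ⟨w, hw⟩ := SilentShells.TwoAxes.exists_cross_of_skew A (CrossFlow.skew_of_inner_self_eq_zero hskew)
  have h := hE xOne xOne_mem
  rw [sub_zero, hw, hw] at h
  have e0 := congrArg (fun u : E3 => u 0) h
  have e1 := congrArg (fun u : E3 => u 1) h
  have e2 := congrArg (fun u : E3 => u 2) h
  simp only [fderiv_xOne_apply, cross_apply_zero, cross_apply_one, cross_apply_two, conicalField_xOne_apply, xOne_apply, mul_one]
    at e0 e1 e2
  simp only [Matrix.cons_val_zero, Matrix.cons_val_one, Matrix.cons_val_two, Matrix.head_cons, Matrix.tail_cons] at e0 e1 e2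
  have hw0 : w 0 = 0 := by linarith
  have hw1 : w 1 = 0 := by linarith
  have hw2 : w 2 = 0 := by linarith
  apply hA0
  ext y i
  rw [hw]
  have hw' : w = 0 := by ext j; fin_cases j <;> simp [hw0, hw1, hw2]
  rw [hw']
  simp [cross, crossProduct]

/-! ### Every ball of the cone -/

/-- ★ **No symmetry axis on any ball of the cone**: for every ball `B ⊆ coneSet` there is no non-zero skew `A` with `Du(y)[A y] = A u(y)`
on `B` (a fortiori none with constant swirl). -/
theorem noAxis_ball {c : E3} {r : ℝ} (hr : 0 < r) (hB : ball c r ⊆ coneSet) :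
    ¬ ∃ A : E3 →L[ℝ] E3, IsSkewAxis A ∧ IsEquivariantOn (ball c r) 0 A (conicalField potential) ∧
      HasConstantSwirlOn (ball c r) 0 A (conicalField potential) := by
  rintro ⟨A, hA, hE, -⟩
  set d : E3 → E3 := fun y => fderiv ℝ (conicalField potential) y (A y) - A (conicalField potential y) with hd
  have h₁ : ∀ y ∈ ball c r, d y = 0 := fun y hy => by
    have h := hE y hy
    rw [sub_zero] at h
    simp only [hd, h, sub_self]
  have h₂ : ∀ y : E3, -y ∈ ball c r → d y = 0 := fun y hy => by
    have h := hE (-y) hy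
    have hyc : y ∈ coneSet := by simpa using neg_mem_coneSet (hB hy)
    rw [sub_zero, map_neg, fderiv_conicalField_neg hyc, conicalField_neg hyc, map_neg, map_neg, neg_inj] at h
    simp only [hd, h, sub_self]
  have hdA : AnalyticOnNhd ℝ d {y : E3 | 0 < y 2} := fun y hy => analyticAt_defect A (upperHalf_subset_coneSet hy)
  have hzero := eqOn_zero_upperHalf_of_ball hdA hr h₁ h₂
  refine not_isEquivariantOn_coneBall hA fun y hy => ?_
  have := hzero (coneBall_subset_upperHalf hy)
  rw [sub_zero]
  exact sub_eq_zero.1 this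

/-- The vorticity is even: `curl u (−x) = curl u (x)` on the cone. -/
theorem curl_conicalField_neg (hx : x ∈ coneSet) : curl (conicalField potential) (-x) = curl (conicalField potential) x := by
  rw [curl_eq_curlCLM, curl_eq_curlCLM, fderiv_conicalField_neg hx]

/-- ★ **`curl u ≢ 0` on every ball of the cone.** -/
theorem exists_curl_ne_zero_ball {c : E3} {r : ℝ} (hr : 0 < r) (hB : ball c r ⊆ coneSet) :
    ∃ y ∈ ball c r, curl (conicalField potential) y ≠ 0 := by
  by_contra h
  simp only [not_exists, not_and, not_not] at h
  have h₂ : ∀ y : E3, -y ∈ ball c r → curl (conicalField potential) y = 0 := fun y hy => by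
    have hyc : y ∈ coneSet := by simpa using neg_mem_coneSet (hB hy)
    rw [← curl_conicalField_neg hyc]
    exact h (-y) hy
  have hcA : AnalyticOnNhd ℝ (curl (conicalField potential)) {y : E3 | 0 < y 2} := fun y hy =>
    analyticAt_curl (upperHalf_subset_coneSet hy)
  have hzero := eqOn_zero_upperHalf_of_ball hcA hr h h₂
  exact curl_conicalField_xOne_ne_zero (hzero (coneBall_subset_upperHalf xOne_mem))

/-- `IsSteadyNSOn` restricts to subsets. -/
theorem isSteadyNSOn_mono {U W : Set E3} {V : E3 → E3} {p : E3 → ℝ} (h : IsSteadyNSOn U V p) (hW : W ⊆ U) : IsSteadyNSOn W V p :=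
  ⟨h.1.mono hW, h.2.1.mono hW, fun y hy => h.2.2.1 y (hW hy), fun y hy => h.2.2.2 y (hW hy)⟩

/-- ★★ **K♯ on EVERY ball of the cone.**  For every ball `B ⊆ coneSet = {N > 0}` (any centre, any radius): `u = conicalField Φ`,
`p = conicalPressure Φ` are real-analytic on `B`, a classical steady Navier–Stokes flow there, unthreaded and `(−1)`-homogeneous about
the vertex `0`, with `curl u ≢ 0` on `B`, and NOT infinitesimally axisymmetric (with or without constant swirl) about any axis through
`0` on `B` — all seven clauses of `PoloidalConicalFlows` on `B`. -/
theorem poloidalConicalFlows_everyBall {c : E3} {r : ℝ} (hr : 0 < r) (hB : ball c r ⊆ coneSet) :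
    AnalyticOnNhd ℝ (conicalField potential) (ball c r) ∧ AnalyticOnNhd ℝ (conicalPressure potential) (ball c r) ∧
      IsSteadyNSOn (ball c r) (conicalField potential) (conicalPressure potential) ∧
      IsUnthreadedOn (ball c r) 0 (conicalField potential) ∧ (∃ y ∈ ball c r, curl (conicalField potential) y ≠ 0) ∧
      IsMinusOneHomogeneousOn (ball c r) 0 (conicalField potential) ∧
      ¬ ∃ A : E3 →L[ℝ] E3, IsSkewAxis A ∧ IsEquivariantOn (ball c r) 0 A (conicalField potential) ∧
        HasConstantSwirlOn (ball c r) 0 A (conicalField potential) := by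
  obtain ⟨hV, hp, hNS, hU, hH, -⟩ := steadyNS_on_coneSet
  exact ⟨fun y hy => hV y (hB hy), fun y hy => hp y (hB hy), isSteadyNSOn_mono hNS hB, fun y hy => hU y (hB hy),
    exists_curl_ne_zero_ball hr hB, fun y hy => hH y (hB hy), noAxis_ball hr hB⟩

end ConicalWitness

end Summit.NavierStokesRegularity.NavierStokesRegularity.Theorems.PoloidalLiouville.AzimuthalCartan

end
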